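import Summits.Ventures.HodgeRepro2.T5EvenValuationNorm

/-!
# Isotropy of hermitian 3-spaces at an inert place, modulo the norm theorem for units
(Tier-5 support, N3)

The N3 record uses the printed fact «a hermitian form in ≥ 3 variables over a non-archimedean local
field is isotropic» (the «isotropy of `V_v`» cell of CHECK-N3 §§22–26). This file reduces it, at an
INERT place, to the single printed input it really rests on — **the norm theorem for units of an
unramified extension, `N_{E/F}(𝒪_E^×) = 𝒪_F^×`** (Serre, Local Fields, V §2 Prop. 3; taken as the
hypothesis `hnorm : ∀ b ∈ R₀ˣ, ∃ z, σ z · z = b`) — by the classical argument: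

1. a non-zero hermitian form has a non-isotropic vector `v₁` (polarisation with a scalar `c` such
   that `σ c ≠ c`: `sesqForm_eq_zero_of_forall_self_eq_zero`, `exists_sesqForm_self_ne_zero`);
2. the orthogonal of `v₁` contains a non-isotropic vector `v₂` when `H` is invertible
   (`exists_orthogonal_sesqForm_self_ne_zero`), and a non-zero `v₃ ⊥ v₁, v₂` exists
   (`T5HermitianIsotropicForm.exists_orthogonal_ne_zero`);
3. if `v₃` is isotropic we are done; otherwise `⟨v₁,v₁⟩, ⟨v₂,v₂⟩, ⟨v₃,v₃⟩ ∈ F^×` and two of them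
   have the same parity of valuation (`exists_even_sub_of_three`), so their quotient is a unit of
   `R₀` times `ϖ^(2m)` (`T5EvenValuationNorm.exists_isInteger_unit_mul_zpow` + the units of `𝒪_E`
   fixed by `σ` lie in `R₀ˣ`), hence a norm `σ z · z` by `hnorm` and `N(ϖ^m) = ϖ^(2m)`
   (`exists_norm_eq_neg_div_of_even_sub`); then `z • v_i + v_j` is isotropic
   (`exists_isotropic_of_orthogonal`).

Main statement `exists_isotropic_of_norm_surjective`: at an inert place (`R₀` a DVR with
uniformiser `ϖ`, `E/F` quadratic with Galois conjugation `σ`, `𝒪_E` local, `𝔭 𝒪_E = 𝔭_E`), given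
`hnorm`, every hermitian `3 × 3` matrix `H` over `E` with `IsUnit H.det` has a non-zero isotropic
vector. What stays prose: the norm theorem itself (printed). No L-value anywhere (README §8(d): NO).
-/

namespace Summit.Ventures.HodgeRepro2.T5InertIsotropyOfNormUnits

open T5UnitaryGroupIsometry T5HermitianIsotropicForm

section Polarisation

variable {E : Type*} [Field E] [StarRing E]

/-- `⟨e_i, w⟩ = (H w)_i`. -/
theorem sesqForm_single_left (H : Matrix (Fin 3) (Fin 3) E) (i : Fin 3) (w : Fin 3 → E) :
    sesqForm H (Pi.single i 1) w = H.mulVec w i := by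
  have hs : star (Pi.single i (1 : E) : Fin 3 → E) = Pi.single i 1 := by
    ext j
    by_cases h : j = i <;> simp [h]
  show star (Pi.single i (1 : E) : Fin 3 → E) ⬝ᵥ (H.mulVec w) = H.mulVec w i
  rw [hs, single_dotProduct, one_mul]

/-- Polarisation: if every vector is isotropic and some scalar `c` has `star c ≠ c`, the form is
zero. -/
theorem sesqForm_eq_zero_of_forall_self_eq_zero {c : E} (hc : star c ≠ c)
    (H : Matrix (Fin 3) (Fin 3) E) (h : ∀ v, sesqForm H v v = 0) (v w : Fin 3 → E) :
    sesqForm H v w = 0 := by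
  have h1 : sesqForm H v w + sesqForm H w v = 0 := by
    have := h (v + w)
    rw [sesqForm_add_left, sesqForm_add_right, sesqForm_add_right, h v, h w] at this
    linear_combination this
  have h2 : star c * sesqForm H v w + c * sesqForm H w v = 0 := by
    have := h (c • v + w)
    simp only [sesqForm_add_left, sesqForm_add_right, sesqForm_smul_left, sesqForm_smul_right,
      h v, h w] at this
    linear_combination this
  have h4 : (star c - c) * sesqForm H v w = 0 := by linear_combination h2 - c * h1
  rcases mul_eq_zero.mp h4 with h5 | h5
  · exact absurd (sub_eq_zero.mp h5) hc
  · exact h5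

/-- A non-zero form has a non-isotropic vector. -/
theorem exists_sesqForm_self_ne_zero {c : E} (hc : star c ≠ c) {H : Matrix (Fin 3) (Fin 3) E}
    (hH0 : H ≠ 0) : ∃ v, sesqForm H v v ≠ 0 := by
  by_contra hcon
  have hall : ∀ v, sesqForm H v v = 0 := fun v => by_contra fun hv => hcon ⟨v, hv⟩
  apply hH0
  rw [← sesqForm_eq_iff H 0]
  intro v w
  rw [sesqForm_eq_zero_of_forall_self_eq_zero hc H hall v w]
  simp [sesqForm_apply]

/-- The orthogonal of a non-isotropic vector contains a non-isotropic vector (`H` invertible). -/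
theorem exists_orthogonal_sesqForm_self_ne_zero {c : E} (hc : star c ≠ c)
    {H : Matrix (Fin 3) (Fin 3) E} (hdet : IsUnit H.det) {v₁ : Fin 3 → E}
    (ha : sesqForm H v₁ v₁ ≠ 0) : ∃ w, sesqForm H v₁ w = 0 ∧ sesqForm H w w ≠ 0 := by
  by_contra hcon
  have hiso : ∀ w, sesqForm H v₁ w = 0 → sesqForm H w w = 0 :=
    fun w hw => by_contra fun h => hcon ⟨w, hw, h⟩
  have hpol : ∀ w w', sesqForm H v₁ w = 0 → sesqForm H v₁ w' = 0 → sesqForm H w w' = 0 := by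
    intro w w' hw hw'
    have h1 : sesqForm H w w' + sesqForm H w' w = 0 := by
      have := hiso (w + w') (by rw [sesqForm_add_right, hw, hw', add_zero])
      rw [sesqForm_add_left, sesqForm_add_right, sesqForm_add_right, hiso w hw, hiso w' hw'] at this
      linear_combination this
    have h2 : star c * sesqForm H w w' + c * sesqForm H w' w = 0 := by
      have := hiso (c • w + w')
        (by rw [sesqForm_add_right, sesqForm_smul_right, hw, hw', mul_zero, add_zero])
      simp only [sesqForm_add_left, sesqForm_add_right, sesqForm_smul_left, sesqForm_smul_right,
        hiso w hw, hiso w' hw'] at this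
      linear_combination this
    have h4 : (star c - c) * sesqForm H w w' = 0 := by linear_combination h2 - c * h1
    rcases mul_eq_zero.mp h4 with h5 | h5
    · exact absurd (sub_eq_zero.mp h5) hc
    · exact h5
  obtain ⟨w₀, hw₀, hw₀v, -⟩ := exists_orthogonal_ne_zero H v₁ v₁
  have hall : ∀ x, sesqForm H x w₀ = 0 := by
    intro x
    have hx : x = (sesqForm H v₁ x / sesqForm H v₁ v₁) • v₁ +
        (x - (sesqForm H v₁ x / sesqForm H v₁ v₁) • v₁) := by abel
    have hperp : sesqForm H v₁ (x - (sesqForm H v₁ x / sesqForm H v₁ v₁) • v₁) = 0 := by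
      rw [sesqForm_sub_right, sesqForm_smul_right, div_mul_cancel₀ _ ha, sub_self]
    rw [hx, sesqForm_add_left, sesqForm_smul_left, hw₀v, mul_zero, zero_add]
    exact hpol _ _ hperp hw₀v
  apply hw₀
  refine Matrix.eq_zero_of_mulVec_eq_zero hdet.ne_zero ?_
  ext i
  rw [← sesqForm_single_left, hall]
  rfl

/-- Two orthogonal vectors `u, u'` with `⟨u',u'⟩ ≠ 0` and a scalar `z` with
`N(z)⟨u,u⟩ + ⟨u',u'⟩ = 0` give the non-zero isotropic vector `z • u + u'`. -/
theorem exists_isotropic_of_orthogonal {H : Matrix (Fin 3) (Fin 3) E} (hH : H.IsHermitian)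
    {u u' : Fin 3 → E} (huu' : sesqForm H u u' = 0) (hu' : sesqForm H u' u' ≠ 0) {z : E}
    (hz : star z * z * sesqForm H u u + sesqForm H u' u' = 0) :
    ∃ x : Fin 3 → E, x ≠ 0 ∧ sesqForm H x x = 0 := by
  have hu'u : sesqForm H u' u = 0 := by
    rw [← star_sesqForm_of_isHermitian hH u u', huu', star_zero]
  refine ⟨z • u + u', ?_, ?_⟩
  · intro h0
    have : sesqForm H u' (z • u + u') = 0 := by rw [h0]; simp [sesqForm_apply]
    rw [sesqForm_add_right, sesqForm_smul_right, hu'u, mul_zero, zero_add] at this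
    exact hu' this
  · simp only [sesqForm_add_left, sesqForm_add_right, sesqForm_smul_left, sesqForm_smul_right,
      huu', hu'u]
    linear_combination hz

end Polarisation

section Parity

/-- Among three integers two have an even difference. -/
theorem exists_even_sub_of_three (k₁ k₂ k₃ : ℤ) :
    Even (k₁ - k₂) ∨ Even (k₁ - k₃) ∨ Even (k₂ - k₃) := by
  simp only [Int.even_sub]
  tauto

end Parity

section Inert

variable {R₀ F E : Type*} [CommRing R₀] [IsDomain R₀] [IsDiscreteValuationRing R₀] [Field F]
  [Field E] [Algebra R₀ F] [IsFractionRing R₀ F] [Algebra F E] [Algebra R₀ E]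
  [IsScalarTower R₀ F E] [FiniteDimensional F E] [Algebra.IsSeparable F E]
  [IsLocalRing (integralClosure R₀ E)]

/-- A non-zero `σ`-fixed element of `E` is a unit of `R₀` times a power of the uniformiser. -/
theorem exists_unit_mul_zpow_of_fixed (h2 : Module.finrank F E = 2) (σ : E ≃ₐ[F] E) (hσ : σ ≠ 1)
    (hunr : Ideal.map (algebraMap R₀ (integralClosure R₀ E)) (IsLocalRing.maximalIdeal R₀) =
      IsLocalRing.maximalIdeal (integralClosure R₀ E))
    {ϖ : R₀} (hϖ : Irreducible ϖ) {α : E} (hα : σ α = α) (hα0 : α ≠ 0) :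
    ∃ (r : R₀ˣ) (k : ℤ), α = algebraMap R₀ E r * algebraMap R₀ E ϖ ^ k := by
  obtain ⟨w, k, hw, hw', hαw⟩ :=
    T5EvenValuationNorm.exists_isInteger_unit_mul_zpow (F := F) hunr hϖ hα0
  have hϖ0 : algebraMap R₀ E ϖ ≠ 0 := T5EvenValuationNorm.algebraMap_uniformiser_ne_zero (F := F) hϖ
  have hw0 : w ≠ 0 := by
    rintro rfl
    exact hα0 (by rw [hαw, zero_mul])
  letI := T5StarOfInvolution.starRingOfQuadratic h2 σ hσ
  have hτ := T5QuadraticAutomorphism.apply_apply h2 σ hσ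
  have hstar : ∀ z : E, star z = σ z := fun z => T5StarOfInvolution.star_eq σ.toRingEquiv hτ z
  have hwfix : star w = w := by
    have hw_eq : w = α * (algebraMap R₀ E ϖ ^ k)⁻¹ := by
      rw [hαw, mul_assoc, mul_inv_cancel₀ (zpow_ne_zero k hϖ0), mul_one]
    rw [hstar, hw_eq, map_mul, map_inv₀, map_zpow₀, T5EvenValuationNorm.algEquiv_algebraMap, hα]
  obtain ⟨r, hr⟩ := T5SelfDualLatticeDet.exists_algebraMap_unit_eq_of_star_eq_of_isInteger
    (fun z hz => (T5StarOfInvolution.star_eq_self_iff_mem_range h2 σ hσ z).mp hz) hwfix hw0 hw hw'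
  exact ⟨r, k, by rw [hr, hαw]⟩

omit [FiniteDimensional F E] [Algebra.IsSeparable F E] [IsLocalRing (integralClosure R₀ E)] in
/-- If `α, β ∈ F^×` (as `σ`-fixed elements of `E`) have valuations of the same parity and every
unit of `R₀` is a norm, then `−β/α` is a norm `σ z · z`. -/
theorem exists_norm_eq_neg_div_of_even_sub (σ : E ≃ₐ[F] E)
    {ϖ : R₀} (hϖ : Irreducible ϖ) (hnorm : ∀ b : R₀ˣ, ∃ z : E, σ z * z = algebraMap R₀ E b)
    {α β : E} {rα rβ : R₀ˣ} {kα kβ : ℤ}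
    (hα : α = algebraMap R₀ E rα * algebraMap R₀ E ϖ ^ kα)
    (hβ : β = algebraMap R₀ E rβ * algebraMap R₀ E ϖ ^ kβ) (heven : Even (kβ - kα)) :
    ∃ z : E, σ z * z = -(β / α) := by
  obtain ⟨m, hm⟩ := heven
  obtain ⟨z₀, hz₀⟩ := hnorm (-(rβ * rα⁻¹))
  have hϖ0 : algebraMap R₀ E ϖ ≠ 0 := T5EvenValuationNorm.algebraMap_uniformiser_ne_zero (F := F) hϖ
  have hrα : algebraMap R₀ E rα ≠ 0 := T5GaloisCartanThree.algebraMap_unit_ne_zero (F := F) rα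
  refine ⟨z₀ * algebraMap R₀ E ϖ ^ m, ?_⟩
  have hkβ : kβ = kα + 2 * m := by omega
  rw [map_mul, mul_mul_mul_comm, hz₀, T5EvenValuationNorm.norm_zpow_uniformiser σ hϖ m, hα, hβ,
    hkβ, zpow_add₀ hϖ0, Units.val_neg, Units.val_mul, map_neg, map_mul, map_units_inv]
  field_simp

/-- **Isotropy at an inert place, modulo the norm theorem for units.** `R₀` a DVR with uniformiser
`ϖ`, `E/F` quadratic with Galois conjugation `σ`, `𝒪_E` local with `𝔭 𝒪_E = 𝔭_E`, and every unit
of `R₀` a norm from `E` (`hnorm`): every hermitian `3 × 3` matrix `H` over `E` with `IsUnit H.det`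
has a non-zero isotropic vector. -/
theorem exists_isotropic_of_norm_surjective (h2 : Module.finrank F E = 2) (σ : E ≃ₐ[F] E)
    (hσ : σ ≠ 1)
    (hunr : Ideal.map (algebraMap R₀ (integralClosure R₀ E)) (IsLocalRing.maximalIdeal R₀) =
      IsLocalRing.maximalIdeal (integralClosure R₀ E))
    {ϖ : R₀} (hϖ : Irreducible ϖ) (hnorm : ∀ b : R₀ˣ, ∃ z : E, σ z * z = algebraMap R₀ E b)
    {H : Matrix (Fin 3) (Fin 3) E}
    (hH : letI := T5StarOfInvolution.starRingOfQuadratic h2 σ hσ; H.IsHermitian)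
    (hdet : IsUnit H.det) :
    letI := T5StarOfInvolution.starRingOfQuadratic h2 σ hσ
    ∃ x : Fin 3 → E, x ≠ 0 ∧ sesqForm H x x = 0 := by
  letI := T5StarOfInvolution.starRingOfQuadratic h2 σ hσ
  have hτ := T5QuadraticAutomorphism.apply_apply h2 σ hσ
  have hstar : ∀ z : E, star z = σ z := fun z => T5StarOfInvolution.star_eq σ.toRingEquiv hτ z
  obtain ⟨c, hc⟩ : ∃ c : E, σ c ≠ c := by
    by_contra hcon
    have hall : ∀ c : E, σ c = c := fun c => by_contra fun h => hcon ⟨c, h⟩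
    exact hσ (AlgEquiv.ext hall)
  have hc' : star c ≠ c := by rw [hstar]; exact hc
  have hH0 : H ≠ 0 := by
    rintro rfl
    simp at hdet
  obtain ⟨v₁, ha⟩ := exists_sesqForm_self_ne_zero hc' hH0
  obtain ⟨v₂, hv₁₂, hb⟩ := exists_orthogonal_sesqForm_self_ne_zero hc' hdet ha
  obtain ⟨v₃, hv₃0, hv₁₃, hv₂₃⟩ := exists_orthogonal_ne_zero H v₁ v₂
  by_cases hcc : sesqForm H v₃ v₃ = 0
  · exact ⟨v₃, hv₃0, hcc⟩
  -- the three norms are σ-fixed and non-zero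
  have hfix : ∀ v, σ (sesqForm H v v) = sesqForm H v v := fun v => by
    rw [← hstar]; exact star_sesqForm_self hH v
  obtain ⟨r₁, k₁, h₁⟩ := exists_unit_mul_zpow_of_fixed h2 σ hσ hunr hϖ (hfix v₁) ha
  obtain ⟨r₂, k₂, h₂⟩ := exists_unit_mul_zpow_of_fixed h2 σ hσ hunr hϖ (hfix v₂) hb
  obtain ⟨r₃, k₃, h₃⟩ := exists_unit_mul_zpow_of_fixed h2 σ hσ hunr hϖ (hfix v₃) hcc
  -- the isotropic vector from a pair of orthogonal vectors with norms of the same parity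
  have key : ∀ (u u' : Fin 3 → E) (ru ru' : R₀ˣ) (ku ku' : ℤ), sesqForm H u u' = 0 →
      sesqForm H u u ≠ 0 → sesqForm H u' u' ≠ 0 →
      sesqForm H u u = algebraMap R₀ E ru * algebraMap R₀ E ϖ ^ ku →
      sesqForm H u' u' = algebraMap R₀ E ru' * algebraMap R₀ E ϖ ^ ku' → Even (ku' - ku) →
      ∃ x : Fin 3 → E, x ≠ 0 ∧ sesqForm H x x = 0 := by
    intro u u' ru ru' ku ku' huu' hu hu' hru hru' heven
    obtain ⟨z, hz⟩ := exists_norm_eq_neg_div_of_even_sub σ hϖ hnorm hru hru' heven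
    refine exists_isotropic_of_orthogonal hH huu' hu' (z := z) ?_
    rw [hstar, hz]
    field_simp
    ring
  rcases exists_even_sub_of_three k₁ k₂ k₃ with h12 | h13 | h23
  · exact key v₂ v₁ r₂ r₁ k₂ k₁ (by rw [← star_sesqForm_of_isHermitian hH v₁ v₂, hv₁₂, star_zero])
      hb ha h₂ h₁ h12
  · exact key v₃ v₁ r₃ r₁ k₃ k₁ (by rw [← star_sesqForm_of_isHermitian hH v₁ v₃, hv₁₃, star_zero])
      hcc ha h₃ h₁ h13
  · exact key v₃ v₂ r₃ r₂ k₃ k₂ (by rw [← star_sesqForm_of_isHermitian hH v₂ v₃, hv₂₃, star_zero])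
      hcc hb h₃ h₂ h23

end Inert

end Summit.Ventures.HodgeRepro2.T5InertIsotropyOfNormUnits
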